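import Literature.Barriers.HubbardSuperconductivity.HohenbergMerminWagnerPairing
import Literature.MathematicalPhysics.QuantumLattice.HubbardHubbardModelKomaTasakiProofs
import HarnessLib

/-!
# The 2D Hubbard model at `T > 0`: no macroscopic eigenvalue of the transverse spin kernel
# `⟨S⁺_x S⁻_y⟩_{β,L}` and of the on-site pair kernel — no magnetic order with ANY ordering vector,
# no `η`/finite-momentum on-site pair condensation

Topic `MathematicalPhysics/QuantumLattice` (companion of `HubbardHubbardModelKomaTasakiProofs`,
which PROVES Koma–Tasaki's Theorem for the Hubbard model on the tori `(ℤ/Lℤ)²`: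
`koma_tasaki_magnetic_holds` — `|⟨S⁺_x S⁻_y⟩_{β,L}| ≤ C (dist(x,y)+1)^{-f}`, eq. (3) — and
`koma_tasaki_2d_holds` — the on-site pair bound, eq. (2)). Those decay bounds are turned there
(and in `HubbardHubbardModelProofs`) into the absence of long-range order of the UNIFORM modes
(`not_hasTorusLRO_thermalSpinCorr`, `not_hasTorusLRO_thermalPairCorr`: the `q = 0` magnetisation
`Σ_x S⁻_x` and the `q = 0` pair field). The remark after the Theorem ("The above bounds rigorously
rule out the possibility of the corresponding magnetic ordering") is stronger: a power-law bound on
the KERNEL controls every mode at once. By the Schur test of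
`Literature.Barriers.HubbardSuperconductivity.norm_quadForm_eventually_le` (largest eigenvalue
`≤` largest absolute row sum, [HornJohnson2012, Cor. 6.1.5]) this file proves, for all `t, U, μ`,
every `0 < β < ∞` and every `ε > 0`, eventually in the side `L` and for EVERY envelope
`φ : (ℤ/Lℤ)² → ℂ`:

* `norm_gibbsState_spinMode_eventually_le` —
  `|⟨(Σ_x φ_x S⁻_x)† (Σ_y φ_y S⁻_y)⟩_{β,L}| = |Σ_{x,y} φ̄_x ⟨S⁺_x S⁻_y⟩_{β,L} φ_y| ≤ ε L² Σ_x |φ_x|²`: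
  the transverse spin kernel has no eigenvalue of order `|Λ| = L²`. With `φ_x = L⁻¹ e^{iq·x}` this
  is the absence of transverse magnetic order with ordering vector `q` — ferromagnetic (`q = 0`),
  Néel (`q = (π,π)`), spiral or incommensurate / stripe-modulated spin-density-wave patterns alike
  — at every positive temperature, for every filling and interaction;
* `norm_gibbsState_onSitePairMode_eventually_le` — the same for the on-site pair kernel
  `⟨c†_{x↑}c†_{x↓} c_{y↓}c_{y↑}⟩_{β,L}` (uniform `s`-wave, `η`-pairing at `q = (π,π)`,
  Fulde–Ferrell–Larkin–Ovchinnikov envelopes): no on-site pair mode is macroscopically occupied.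
  (For extended pairs with a form factor see `norm_gibbsState_pairMode_eventually_le` in
  `HohenbergMerminWagnerPairing`.)

Scope: positive temperature, `d = 2`, transverse (`S⁺S⁻`) channel and the Hubbard interaction of
`hubbardTorusWith`; `L₀` depends on `t, U, μ, β, ε` through the constants of
`koma_tasaki_magnetic_holds` / `koma_tasaki_2d_holds`. Nothing is asserted at `T = 0`, about
longitudinal (`S³S³`) kernels, or about the growth rate of the largest eigenvalue (quasi-long-range
order `O(L^{2-f})` is NOT excluded).

Sources: T. Koma, H. Tasaki, PRL **68** (1992) 3248, Theorem eqs. (2), (3) and the remark after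
it [KomaTasakiPRL1992]; C. N. Yang, Rev. Mod. Phys. **34** (1962) 694, §4 (order as a macroscopic
eigenvalue of a reduced density matrix) [Yang1962]; R. A. Horn, C. R. Johnson, *Matrix Analysis*,
2nd ed. (2012), Cor. 6.1.5 [HornJohnson2012]. No definition, no named fact.
-/

noncomputable section

open Matrix Complex Finset Filter Topology
open scoped Matrix.Norms.L2Operator ComplexOrder

namespace Literature.MathematicalPhysics.QuantumLattice

open Literature.Probability.LatticeModels Literature.Barriers.HubbardSuperconductivity

variable {L : ℕ} [NeZero L]

/-- Bilinear expansion of a transverse spin mode with envelope `φ`: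
`⟨(Σ_x φ_x S⁻_x)† (Σ_y φ_y S⁻_y)⟩_β = Σ_x Σ_y φ̄_x ⟨S⁺_x S⁻_y⟩_β φ_y` (`S⁻_x = (S⁺_x)†`).
[cite: KomaTasakiPRL1992, eq. (3)] -/
theorem gibbsState_conjTranspose_spinMode_mul (β : ℝ)
    (H : Matrix (Finset (Orb (FermionTorus 2 L))) (Finset (Orb (FermionTorus 2 L))) ℂ)
    (φ : TorusSite 2 L → ℂ) :
    gibbsState β H ((∑ x : TorusSite 2 L, φ x • (siteSpinPlus x)ᴴ)ᴴ *
        ∑ y : TorusSite 2 L, φ y • (siteSpinPlus y)ᴴ) =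
      ∑ x : TorusSite 2 L, ∑ y : TorusSite 2 L,
        star (φ x) * H.thermalCorr β (siteSpinPlus x) (siteSpinPlus y)ᴴ * φ y := by
  rw [conjTranspose_sum, Finset.sum_mul, map_sum]
  refine Finset.sum_congr rfl fun x _ => ?_
  rw [Finset.mul_sum, map_sum]
  refine Finset.sum_congr rfl fun y _ => ?_
  rw [conjTranspose_smul, conjTranspose_conjTranspose, Matrix.smul_mul, Matrix.mul_smul, smul_smul,
    map_smul, smul_eq_mul, Matrix.thermalCorr]
  ring

/-- **No transverse magnetic order with any ordering vector in the two-dimensional Hubbard model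
at `T > 0` (no macroscopic eigenvalue of the spin kernel).** For all `t, U, μ`, every `β > 0` and
every `ε > 0` there is `L₀` such that for all `L ≥ L₀` and every `φ : (ℤ/Lℤ)² → ℂ`,
`|⟨(Σ_x φ_x S⁻_x)† (Σ_y φ_y S⁻_y)⟩_{β,L}| ≤ ε L² Σ_x |φ_x|²`: the largest eigenvalue of the positive
kernel `⟨S⁺_x S⁻_y⟩_{β,L}` is `o(L²)`. Proof: Koma–Tasaki's eq. (3) (`koma_tasaki_magnetic_holds`:
`|⟨S⁺_xS⁻_y⟩| ≤ C (dist+1)^{-f}`, `f > 0`, uniformly in `L`) and the Schur test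
`norm_quadForm_eventually_le`. [cite: KomaTasakiPRL1992, Theorem eq. (3) and the remark after the
Theorem ("rule out the possibility of the corresponding magnetic ordering")]
[cite: HornJohnson2012, Cor. 6.1.5 (lit p0486)] -/
theorem norm_gibbsState_spinMode_eventually_le (t U μ : ℝ) {β : ℝ} (hβ : 0 < β) {ε : ℝ}
    (hε : 0 < ε) :
    ∃ L₀ : ℕ, ∀ (L : ℕ) [NeZero L], L₀ ≤ L → ∀ φ : TorusSite 2 L → ℂ,
      ‖gibbsState β (hubbardTorusWith 2 L t U μ) ((∑ x : TorusSite 2 L, φ x • (siteSpinPlus x)ᴴ)ᴴ *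
          ∑ y : TorusSite 2 L, φ y • (siteSpinPlus y)ᴴ)‖ ≤ ε * (L : ℝ) ^ 2 * ∑ x, ‖φ x‖ ^ 2 := by
  obtain ⟨⟨f, hf, C, hC⟩, -⟩ := koma_tasaki_magnetic_holds t U μ β hβ
  obtain ⟨L₀, hL₀⟩ := norm_quadForm_eventually_le (d := 2) two_ne_zero (C := C) hf hε
  refine ⟨L₀, fun L _ hL φ => ?_⟩
  rw [gibbsState_conjTranspose_spinMode_mul]
  exact hL₀ L hL _ (fun x y => hC L x y) φ

/-- Bilinear expansion of an on-site pair mode with envelope `φ`: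
`⟨(Σ_x φ_x c_{x↓}c_{x↑})† (Σ_y φ_y c_{y↓}c_{y↑})⟩_β = Σ_x Σ_y φ̄_x ⟨(c_{x↓}c_{x↑})† c_{y↓}c_{y↑}⟩_β φ_y`.
[cite: KomaTasakiPRL1992, eq. (2)] -/
theorem gibbsState_conjTranspose_onSitePairMode_mul (β : ℝ)
    (H : Matrix (Finset (Orb (FermionTorus 2 L))) (Finset (Orb (FermionTorus 2 L))) ℂ)
    (φ : TorusSite 2 L → ℂ) :
    gibbsState β H ((∑ x : TorusSite 2 L, φ x • onSitePair x)ᴴ *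
        ∑ y : TorusSite 2 L, φ y • onSitePair y) =
      ∑ x : TorusSite 2 L, ∑ y : TorusSite 2 L,
        star (φ x) * H.thermalCorr β (onSitePair x)ᴴ (onSitePair y) * φ y := by
  rw [conjTranspose_sum, Finset.sum_mul, map_sum]
  refine Finset.sum_congr rfl fun x _ => ?_
  rw [Finset.mul_sum, map_sum]
  refine Finset.sum_congr rfl fun y _ => ?_
  rw [conjTranspose_smul, Matrix.smul_mul, Matrix.mul_smul, smul_smul, map_smul, smul_eq_mul,
    Matrix.thermalCorr]
  ring

/-- **No on-site pair condensation into any mode in the two-dimensional Hubbard model at `T > 0`**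
(uniform `s`-wave, `η`-pairing, finite-momentum envelopes): for all `t, U, μ`, every `β > 0` and
every `ε > 0` there is `L₀` such that for all `L ≥ L₀` and every `φ : (ℤ/Lℤ)² → ℂ`,
`|⟨(Σ_x φ_x c_{x↓}c_{x↑})† (Σ_y φ_y c_{y↓}c_{y↑})⟩_{β,L}| ≤ ε L² Σ_x |φ_x|²` — the largest eigenvalue
of the on-site pair kernel is `o(L²) = o(N)` (Yang's criterion fails for every on-site pair mode).
Proof: `koma_tasaki_2d_holds` and the Schur test. [cite: KomaTasakiPRL1992, Theorem eq. (2) and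
the remark after the Theorem ("condensation of ... Cooper pairs or η-pairs")] [cite: Yang1962, §4] -/
theorem norm_gibbsState_onSitePairMode_eventually_le (t U μ : ℝ) {β : ℝ} (hβ : 0 < β) {ε : ℝ}
    (hε : 0 < ε) :
    ∃ L₀ : ℕ, ∀ (L : ℕ) [NeZero L], L₀ ≤ L → ∀ φ : TorusSite 2 L → ℂ,
      ‖gibbsState β (hubbardTorusWith 2 L t U μ) ((∑ x : TorusSite 2 L, φ x • onSitePair x)ᴴ *
          ∑ y : TorusSite 2 L, φ y • onSitePair y)‖ ≤ ε * (L : ℝ) ^ 2 * ∑ x, ‖φ x‖ ^ 2 := by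
  obtain ⟨f, hf, C, hC⟩ := koma_tasaki_2d_holds t U μ β hβ
  obtain ⟨L₀, hL₀⟩ := norm_quadForm_eventually_le (d := 2) two_ne_zero (C := C) hf hε
  refine ⟨L₀, fun L _ hL φ => ?_⟩
  rw [gibbsState_conjTranspose_onSitePairMode_mul]
  exact hL₀ L hL _ (fun x y => hC L x y) φ

end Literature.MathematicalPhysics.QuantumLattice
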